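import Mathlib
import Summits.Ventures.PercRepro2.HCov
import Summits.Ventures.PercRepro2.BHKAvoid
import Summits.Ventures.PercRepro2.ExploreA3
import Summits.Ventures.PercRepro2.RootLeafUSigns
import Summits.Ventures.PercRepro2.RootLeafUYBFWB
import Summits.Ventures.PercRepro2.RootLeafUMult

/-!
# (G4-u): the `b`-side cross-cluster bound on `Q`, and `(MULT)` between two kernel facts
(blind cell PercRepro2, p4 g12; proofs/P4-G12-BNEG.md, S3 v53 item (z))

`(MULT)`: `P(X̄ | R, oL) · P(X̄ | Q, bL) ≥ P(X̄ | R)` (`x_o · x_b ≥ x`) is the tie-class statement of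
record (RootLeafUMult).  Its two factors each dominate the base on their own: `x_o ≥ x` is BHK06 Thm 1.4
on `R` (`ToL_mul_D_le`), and here `x_b ≥ x` is proved — BHK06 Thm 1.4 on `Q = {u ↮ a₂}` for the
up-set `{b ∈ L}` of the cluster of `u` against the up-set `{c ∈ K}` of the cluster of `a₂`
(`bhk_cross_cluster_avoid`), `P(T, bL) · P(Q) ≤ P(Q, bL) · P(T)` (`TbL_mul_Z_le`; `T = Q ∩ {a₂ ↔ c}`),
then the `c ∈ L` mass is added: `P(X̄ | Q) ≥ P(X̄ | R)` since `c ∈ L` forces `a₂ ↮ c` under `Q`.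
Cleared: **`D · B ≤ W · B₀`** (`D_mul_B_le_W_mul_B0`; `B₀ = P(PD, bL) + P(T′, bL)`, `B = P(Q, bL)`,
`W = P(R)`, `D = P(PD)`), i.e. `δ_b^Q := W·B₀ − D·B ≥ 0` of proofs/P4-G10-YBF.md §8 / §11.
So `(MULT)` asks for `x_b ≥ x / x_o` while the kernel has `x_b ≥ x` and `x_o ≥ x`.
-/

namespace Summit.Ventures.PercRepro2

open UnionCluster CovForm

namespace RootLeafU

namespace YBF

section BSide

variable {V : Type*} {E : Type*} [Fintype E] [DecidableEq E] [Fintype V] [DecidableEq V]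
  {R : Type*} [Field R] [LinearOrder R] [IsStrictOrderedRing R]

variable (p : E → R) (ends : E → Sym2 V) (a₂ c b u : V)

omit [Fintype E] [DecidableEq E] [Fintype V] [DecidableEq V] in
/-- `{b ∈ L} ∩ {a₂ ↔ c} ∩ Q = T ∩ {b ∈ L}` (with `Q = {u ↮ a₂}` written from `a₂`, `T = R ∩ {a₂ ↔ c}`). -/
lemma bL_inter_conn_inter_Q :
    connEvent ends u b ∩ connEvent ends a₂ c ∩ avoidAll ends a₂ {u} =
      TEvent ends u a₂ c ∩ connEvent ends u b := by
  ext ω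
  simp only [Set.mem_inter_iff, mem_connEvent, mem_avoidAll, Finset.mem_singleton, forall_eq,
    TEvent, Set.mem_compl_iff]
  tauto

omit [Fintype E] [DecidableEq E] [Fintype V] [DecidableEq V] in
/-- `{a₂ ↔ c} ∩ Q = T`. -/
lemma conn_inter_Q : connEvent ends a₂ c ∩ avoidAll ends a₂ {u} = TEvent ends u a₂ c := by
  ext ω
  simp only [Set.mem_inter_iff, mem_connEvent, mem_avoidAll, Finset.mem_singleton, forall_eq,
    TEvent, Set.mem_compl_iff]
  tauto

/-- **BHK06 Thm 1.4 on `Q` for `b ∈ L` against `a₂ ↔ c`**: `P(T, bL) · P(Q) ≤ P(Q, bL) · P(T)`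
(`bhk_cross_cluster_avoid` with `s = u`, `t = a₂`, `X = {a₂}`, the up-sets `{b ∈ ·}` and `{c ∈ ·}`). -/
theorem TbL_mul_Z_le (hp : IsProbVec p) :
    prob p (TEvent ends u a₂ c ∩ connEvent ends u b) * prob p (avoidAll ends a₂ {u}) ≤
      prob p (avoidAll ends a₂ {u} ∩ connEvent ends u b) * prob p (TEvent ends u a₂ c) := by
  have h := bhk_cross_cluster_avoid p hp ends u a₂ (X := {a₂}) (Finset.mem_singleton_self a₂)
    (isUpperSet_mem_setOf b) (isUpperSet_mem_setOf c)
  rw [← connEvent_eq_clusterInEvent ends u b, ← connEvent_eq_clusterInEvent ends a₂ c,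
    avoid_u_a₂_eq, bL_inter_conn_inter_Q] at h
  have e1 : connEvent ends u b ∩ avoidAll ends a₂ {u} = avoidAll ends a₂ {u} ∩ connEvent ends u b :=
    Set.inter_comm _ _
  rw [e1, conn_inter_Q] at h
  exact h

/-- **`x_b ≥ x`, cleared: `D · B ≤ W · B₀`** — `P(PD) · P(Q, bL) ≤ P(R) · (P(PD, bL) + P(T′, bL))`,
i.e. `P(X̄ | R) ≤ P(X̄ | Q, bL)`: the `b`-side cross-cluster bound plus the `c ∈ L` mass
(`P(X̄ | R) ≤ P(X̄ | Q)`, the branch `T′` of `Q` lies in `X̄`). -/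
theorem D_mul_B_le_W_mul_B0 (hp : IsProbVec p) :
    prob p (PDEvent ends u a₂ c) * prob p (avoidAll ends a₂ {u} ∩ connEvent ends u b) ≤
      prob p (avoidAll ends u {a₂, c}) *
        (prob p (PDEvent ends u a₂ c ∩ connEvent ends u b) +
          prob p (TEvent ends a₂ u c ∩ connEvent ends u b)) := by
  have h := TbL_mul_Z_le p ends a₂ c b u hp
  have hW : prob p (avoidAll ends u {a₂, c}) =
      prob p (PDEvent ends u a₂ c) + prob p (TEvent ends u a₂ c) := by
    have h' := ISplit.prob_PD_add_T p ends u a₂ c Set.univ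
    simp only [Set.inter_univ] at h'
    exact h'.symm
  have hZ := Qsplit_univ p ends u a₂ c
  have hB := Qsplit p ends u a₂ c (connEvent ends u b)
  rw [hZ, hB] at h
  rw [hW, hB]
  have hD := prob_nonneg hp (PDEvent ends u a₂ c)
  have ht := prob_nonneg hp (TEvent ends u a₂ c)
  have htp := prob_nonneg hp (TEvent ends a₂ u c)
  have hbN := prob_nonneg hp (PDEvent ends u a₂ c ∩ connEvent ends u b)
  have hB1 := prob_nonneg hp (TEvent ends u a₂ c ∩ connEvent ends u b)
  have hbp := prob_nonneg hp (TEvent ends a₂ u c ∩ connEvent ends u b)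
  nlinarith [h, mul_nonneg htp hB1, mul_nonneg htp hbN, mul_nonneg htp hbp, mul_nonneg ht hbp,
    mul_nonneg hD hbp]

end BSide

end YBF

end RootLeafU

end Summit.Ventures.PercRepro2
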